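import Summits.BirchSwinnertonDyer.BirchSwinnertonDyer.Theses.CumulativeHeegnerLeopoldt
import Summits.BirchSwinnertonDyer.BirchSwinnertonDyer.Theorems.AdditivePotSupersingularControlOfFacts
import Summits.BirchSwinnertonDyer.BirchSwinnertonDyer.Theorems.CumulativeHeegnerLeopoldtRedSplitControlAtThreeTorsionFree
import Summits.BirchSwinnertonDyer.Rank1Residual.GaloisImage.PropagatedConditionCardEP
import Literature.NumberTheory.EllipticCurves.Serre1967.PotentiallySupersingularNoStableLineProofs
import Literature.NumberTheory.EllipticCurves.AnticyclotomicPrimeDecompositionSplitProofs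
import Literature.NumberTheory.EllipticCurves.AnticyclotomicPrimeDecompositionAboveProofs
import Literature.NumberTheory.GaloisRepresentations.NumberFieldCdTwoProofs
import HarnessLib

/-!
# Crux K4 `RedSplitControlAtThree` (stmt-BirchSwinnertonDyer-24200) of route `CumulativeHeegnerLeopoldt`
# BY NAME, modulo published facts — and modulo POITOU–TATE ONLY

Seat `bsd-line-chl-p2` g0 (cell `bsd-wall`, width prover on K4 under the lead `bsd-line-chl-p1`).
HONEST FRAMING: CONDITIONAL theorems (named-fact hypotheses displayed in each signature); no definition,
no named fact minted, no `sorry`; BSD is not proved by any of this; the item closes only if its own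
(hypothesis-free) signature is proved.

K4 is the anticyclotomic control EQUALITY of the tree's additive currency
(`SchneiderFree.AdditiveControlOnTreeAt 3 κ 𝔭 γ (embAt K 3 𝔭) P`) on the Leopoldt cell of the route:
`E/ℚ` on the wild class O6 at `p = 3`, `E[3]` REDUCIBLE with a rational line NON-ANOMALOUS at every
decomposition group above `3`, a Heegner datum `(N, K, Dt, H, ι, P)` with `P = y_K` of infinite order and
Kolyvagin's theorem as antecedent. It is UTD's crux #5 `WildSplitControlAtThree` (20386) with the onto-image
hypothesis replaced by the reducible non-anomalous cell. The K1 door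
`AdditivePotSupersingularControl.additiveControlOnTreeAt_of_classO6_of_facts` (Jetchev–Skinner–Wan control
at a potentially supersingular additive prime, seven published facts) uses the image hypothesis only through
`E(K)[3] = 0`, and on the reducible cell that input is the UNCONDITIONAL tree lemma
`RedSplitControlAtThreeTorsionFree.forall_nsmul_eq_zero_of_nonAnomalousCell_of_isImaginaryQuadratic`
(`D_𝔓 ≤ res(Γ_K)` at the split prime `3`, so a `K`-rational `3`-torsion point would be a `D_𝔓`-fixed
vector of `E[3]`, which non-anomaly forbids). Hence:

* `redSplitControlAtThree_of_facts` — K4 BY NAME from the SEVEN named facts of the K1 door (Poitou–Tate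
  ×2, local Euler–Poincaré, `cd ≤ 2`, Brink Thm 2 / Cor 1, Serre 1967 §5 Prop. 8);
* `redSplitControlAtThree_of_poitouTate` — K4 BY NAME modulo the two POITOU–TATE facts only, the other
  five being tree theorems (`EP.localEulerPoincareCharacteristic_adicCompletion`,
  `fieldCdLE_two_of_numberField_holds`, `ZpExtension.decomp_not_le_kerSubgroup_of_isAnticyclotomic_holds`,
  `ZpExtension.decomp_not_le_kerSubgroup_above_of_isAnticyclotomic_holds`,
  `Serre1967.noStableDivisibleLine_of_potentiallySupersingular_holds`) — the same residue as UTD's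
  `UniversalToricDescentControl.wildSplitControlAtThree_of_poitouTate` (items 20461/20462).

References: [JetchevSkinnerWan2017] Thm. 3.3.1, Prop. 3.3.4; [Castella2018] Thm. 2.3; [MilneADT2006]
I 2.8, 4.10; [Brink2007] Thm. 2, Cor. 1; [Serre1967GroupesPDivisibles] §5 Prop. 8; [Kolyvagin1990] Thm. A;
[GrossLMS1991] §2; [NeukirchANT1999] I §9; [CastellaGrossiSkinner2025] Thm. A (hypothesis on φ).
-/

noncomputable section

open scoped Classical

open WeierstrassCurve NumberField IsDedekindDomain Field Literature.NumberTheory.EllipticCurves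
  Literature.NumberTheory.EllipticCurves.ModularForms
  Literature.NumberTheory.EllipticCurves.GreenbergSelmer
  Literature.NumberTheory.GaloisRepresentations
  Literature.NumberTheory.GaloisCohomology
  Literature.NumberTheory.EllipticCurves.Rank1Residual
  Summit.BirchSwinnertonDyer.Rank1Residual
  Summit.BirchSwinnertonDyer.Rank1Residual.Additive
  Summit.BirchSwinnertonDyer.Rank1Residual.X11b
  Summit.BirchSwinnertonDyer.BirchSwinnertonDyer.Theorems.SchneiderFree
  Summit.BirchSwinnertonDyer.BirchSwinnertonDyer.Theorems.SchneiderFreeAdditiveX3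

set_option linter.dupNamespace false
set_option autoImplicit false

namespace Summit.BirchSwinnertonDyer.BirchSwinnertonDyer.Theorems.RedSplitControlAtThreeOfFacts

/-- **K4 `RedSplitControlAtThree` BY NAME from the seven published facts of the K1 door.** On the
Leopoldt cell (class O6 at `3`, `E[3]` reducible with a non-anomalous rational line), for every Heegner
datum with `P = y_K` non-torsion and Kolyvagin's theorem as antecedent, exact anticyclotomic control holds
at every frame `(κ, γ, 𝔭 ∣ 3)` of degree one: `AdditivePotSupersingularControl.additiveControlOnTreeAt_of_classO6_of_facts`
with `SplitsIn K 3` from the Heegner hypothesis (`3 ∣ N`), `rank E(K) = 1 ∧ Ш(E/K) < ∞` from `kolyvagin`,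
and `E(K)[3] = 0` from the non-anomalous line
(`RedSplitControlAtThreeTorsionFree.forall_nsmul_eq_zero_of_nonAnomalousCell_of_isImaginaryQuadratic`).
CONDITIONAL on the seven named facts; closes nothing by itself; BSD is not proved by any of this.
[cite: JetchevSkinnerWan2017, Thm. 3.3.1, Prop. 3.3.4 (arXiv:1512.06894 pp. 11–13)]
[cite: Castella2018, Thm. 2.3 (arXiv:1704.06608 p. 5)] [cite: MilneADT2006, Ch. I, Thm. 4.10 and Thm. 2.8]
[cite: Brink2007, Thm. 2 and Cor. 1] [cite: Serre1967GroupesPDivisibles, §5 Prop. 8]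
[cite: Kolyvagin1990, Thm. A] [cite: NeukirchANT1999, Ch. I §9 (9.3)–(9.6)] -/
theorem redSplitControlAtThree_of_facts
    (hPT : ∀ (K : Type) [Field K] [NumberField K], poitouTate_selmerStructure_duality K)
    (hPT2 : ∀ (K : Type) [Field K] [NumberField K], poitouTate_sha_tateDual K)
    (hEP : ∀ (K : Type) [Field K] [NumberField K] (v : HeightOneSpectrum (𝓞 K)),
      localEulerPoincareCharacteristic (v.adicCompletion K))
    (hcd : fieldCdLE_two_of_numberField)
    (hBr : ∀ (K : Type) [Field K] [NumberField K] (p : ℕ) [Fact p.Prime],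
      ZpExtension.decomp_not_le_kerSubgroup_of_isAnticyclotomic K p)
    (hBr2 : ∀ (K : Type) [Field K] [NumberField K] (p : ℕ) [Fact p.Prime],
      ZpExtension.decomp_not_le_kerSubgroup_above_of_isAnticyclotomic K p)
    (hS : Serre1967.noStableDivisibleLine_of_potentiallySupersingular) :
    Summit.BirchSwinnertonDyer.BirchSwinnertonDyer.Theses.CumulativeHeegnerLeopoldt.RedSplitControlAtThree := by
  intro W _ _ N _ K _ _ Dt H ι P hO6 _hRed hcell _hr hN hK hHg _hLd hP hPinf hKoly κ hκ γ _ 𝔭 h𝔭 he hf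
  have hpN : 3 ∣ W.conductorNorm ℤ :=
    (W.dvd_conductorNorm_iff_not_hasGoodReductionAtPrime 3).mpr hO6.2.1.1
  have hsplit : SplitsIn K 3 := splitsIn_of_satisfiesHeegnerHypothesis hN hHg hpN
  obtain ⟨hrank, hSha⟩ := hKoly hK hHg ⟨Dt, H, ι, hP⟩ hPinf
  have hivK : ∀ x : (W.baseChange K).toAffine.Point, 3 • x = 0 → x = 0 :=
    RedSplitControlAtThreeTorsionFree.forall_nsmul_eq_zero_of_nonAnomalousCell_of_isImaginaryQuadratic
      K hK 𝔭 h𝔭 he hf hcell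
  exact AdditivePotSupersingularControl.additiveControlOnTreeAt_of_classO6_of_facts hPT hPT2 hEP hcd hBr
    hBr2 hS W hO6 K hK hsplit hivK κ hκ γ 𝔭 h𝔭 he hf hrank hSha P hPinf

/-- **K4 `RedSplitControlAtThree` BY NAME modulo the two POITOU–TATE facts only** (Poitou–Tate duality
for Selmer structures and `Ш¹(T) ≃ Ш²(T^D)^∨` over number fields — route `UniversalToricDescent` items
20461/20462). The other five inputs of `redSplitControlAtThree_of_facts` are tree theorems: the local
Euler–Poincaré characteristic (`EP.localEulerPoincareCharacteristic_adicCompletion`), `cd_p ≤ 2`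
(`fieldCdLE_two_of_numberField_holds`), Brink Thm 2 / Cor 1
(`ZpExtension.decomp_not_le_kerSubgroup_of_isAnticyclotomic_holds`,
`ZpExtension.decomp_not_le_kerSubgroup_above_of_isAnticyclotomic_holds`) and Serre 1967 §5 Prop. 8
(`Serre1967.noStableDivisibleLine_of_potentiallySupersingular_holds`). CONDITIONAL (two named-fact
hypotheses); closes nothing by itself; BSD is not proved by any of this.
[cite: JetchevSkinnerWan2017, Thm. 3.3.1, Prop. 3.3.4 (arXiv:1512.06894 pp. 11–13)]
[cite: MilneADT2006, Ch. I, Thm. 4.10 and Thm. 2.8] [cite: Brink2007, Thm. 2 and Cor. 1]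
[cite: Serre1967GroupesPDivisibles, §5 Prop. 8] -/
theorem redSplitControlAtThree_of_poitouTate
    (hPT : ∀ (K : Type) [Field K] [NumberField K], poitouTate_selmerStructure_duality K)
    (hPT2 : ∀ (K : Type) [Field K] [NumberField K], poitouTate_sha_tateDual K) :
    Summit.BirchSwinnertonDyer.BirchSwinnertonDyer.Theses.CumulativeHeegnerLeopoldt.RedSplitControlAtThree :=
  redSplitControlAtThree_of_facts hPT hPT2
    (fun K _ _ v ↦
      Summit.BirchSwinnertonDyer.Rank1Residual.GaloisImage.EP.localEulerPoincareCharacteristic_adicCompletion K v)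
    fieldCdLE_two_of_numberField_holds
    (fun K _ _ p _ ↦ ZpExtension.decomp_not_le_kerSubgroup_of_isAnticyclotomic_holds K p)
    (fun K _ _ p _ ↦ ZpExtension.decomp_not_le_kerSubgroup_above_of_isAnticyclotomic_holds K p)
    Serre1967.noStableDivisibleLine_of_potentiallySupersingular_holds

end Summit.BirchSwinnertonDyer.BirchSwinnertonDyer.Theorems.RedSplitControlAtThreeOfFacts

end
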